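import Summits.QuantumFields.BalabanUV.Beta.D1BFx.PackedColumnEnvelope
import Literature.MathematicalPhysics.QuantumFieldTheory.Balaban1983to89.B5Hk163TorusHolderDecay

/-!
# `BalabanUV.Beta.D1BFx.MinimiserColumnGradient` — road «BF-x» for binder row D1, slot (K), PART 24 letter **L-h, PART 1 (THE STRAIGHT COLUMN)**:
# **THE FINE LATTICE GRADIENT OF an2's MINIMISER KERNEL `wH^{(N)}` — THE UNDRESSED `ℋ`-COLUMN `colH (KInvStep d N 0) N` OF THE ONE-SHOT RESOLVENT —
# GAINS EXACTLY ONE POWER OF `N` OVER THE COLUMN ITSELF, UNCONDITIONALLY:**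
# `|wH κ l (z + e_ν − N•q) − wH κ l (z − N•q)| ≤ N^{−(d+3)} · (MD163(d+1)·periodConst(κ₁₆₃(d+1), d)) · e^{−(κ₁₆₃(d+1)∕(d+1))·‖⌊z∕N⌋ − q‖∞}`
# for every `d`, every `N ≥ 1`, all `κ l ν z q` — at `d = 3`: `n⁻⁶` against the column's `n⁻⁵` (`FP.CompositeMinimiserDecay.abs_wH_le`), d-only constants, NO printed hypothesis

HONEST DEPENDENCY (cell records, verbatim): «continuum YM on T⁴ ⇐ BetaPertH ∧ nine spine estimates (0/9 proved); BetaPertH ⇐ (D1) ∧ (D4) ∧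
CAP+tail; G-an2-4 gates asym, D1 and NE2/3/4.»  HONEST FRAMING (cell contract, verbatim): «discharging `BetaPertH` makes Bałaban's UV stability
UNCONDITIONAL — a real constructive-QFT result; it is NOT the continuum limit and NOT the Clay problem.»  THIS MODULE proves ONE estimate about a ROAD
object (an2's typed `U = 1` one-step system on `ℤ^{d+1}`) by composing TREE theorems BY NAME: the b05∕pv15 lineage's certificate for the fine forward
DIFFERENCE of the typed torus minimiser `H_k` — `B5Hk163TorusHolder.dker` (`dker μ λ ν x y := n·(hker μ λ (x + e_ν) y − hker μ λ x y)`) and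
**`B5Hk163TorusHolderDecay.norm_dker_bpt_le`** (strip holomorphy of the derivative multiplier `D163`; n-uniform, torus-uniform, d-only constants
`MD163`, `κ₁₆₃`, `periodConst`) — carried to `ℤ^{d+1}` EXACTLY as d1-formalise-leaf-05 g16's `FP/CompositeMinimiserDecay` carries `B5Hk163Torus.norm_HkOp_le`:
junction `CompositeMinimiserDecay.tsum_wH_pshift_eq_HkOp` (the periodised column IS `N^{−(d+2)}·HkOp`), subtraction of two junctions (`hker(x + e_ν) − hker x =
n⁻¹·dker`: the displayed `1∕n`), de-periodisation `FP/PeriodisationBound.abs_le_of_periodisations`.  It defines nothing, cites nothing as a hypothesis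
(`B5.Prop12Printed` is NOT touched — B5 (1.110) concerns `G = Δ_a⁻¹`, the gluon leg, not `H_k`), mints no `Prop` fact, 0 sorry.  The printed TEXT behind the engine
(locations only, via the engine's docstrings): [B5] = T. Bałaban, CMP **95** (1984) p. 28 bottom – p. 29 top (after (1.63)) «This implies bounds on
(1∕|x′−x|^α)|∂_ν(H_kB)_μ(x′) − ∂_ν(H_kB)_μ(x)| (see the proof of Lemma 2.4 in [2].)» — nothing of it enters as a hypothesis (ABSOLUTE RULE).
WHAT IT IS: the OWNER d1-p2 g23's PART-24 letter L-h («THE CRUX LETTER», `PART24-SPEC-g23.md` c08ae833fffd2503 §2, COMMISSION C-g23-1 journal l.49236) for the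
STRAIGHT column `wH` ∕ `colH (KInvStep d N 0) N` («and the same for the straight `KInv n` column `wH`»), with ITS power `n⁻⁶` at `d = 3` and k-free constants; the
U1 count's `∇h ≍ n⁻²` for `h = cE·colH = n⁴·colH`.  WHAT IT IS NOT: NOT the letter for the DRESSED column `colH (coDressKBmAt (toSite (ctrOff 4 n)) n (KInvStep n 0))`
(PART 2: by `GAN24/CoDressedColumnPairing.colH_coDressKBmAt_eq_sub_grad` the dressed column is THIS column minus the lattice gradient of the block-mean-normalised rooted
tree gauge of it — a pure-gauge difference whose own fine gradient is NOT uniformly `n⁻⁶`; its shape is stated separately, with the count); NOT a (1.22) row; NOT a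
statement that the decider says U1; 0 root-level binders of row D1 discharged (hW ∕ hR-sockets ∕ hSX-socket ∕ D1Tel ∕ D1Rep = 0); (K) NOT closed; NOT D1, NOT `BetaPertH`,
NOT continuum, NOT Clay.

ABSOLUTE RULE (cell charter, verbatim): «No internally-minted statement may enter as a cited fact. Every hypothesis is either kernel-proved in
this package or a verbatim quotation of a PUBLISHED theorem with page reference. The manuscript(s) under audit are NOT citable for their own
disputed steps — they are the thing under adjudication; programme-internal (2001/route/tribunal) claims are never citable.»

CONTENT (every `d`, `N ≥ 1`, torus `M`; [folklore] unless marked [our object]).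
* §1 `summable_wH_translate` (a periodised translate of `wH` is summable: `summable_wH` ∘ the injective `t ↦ c + pshift (NM) t`), `hker_add_unitVec_sub`
  (`hker (x + e_ν) y − hker x y = n⁻¹·dker`), **`tsum_wH_diff_pshift_eq_dker`** — THE JUNCTION FOR THE DIFFERENCE:
  `Σ_t [wH κ l (x − N•q + (NM)•t + e_ν) − wH κ l (x − N•q + (NM)•t)] = N^{−(d+2)}·N⁻¹·dker N M κ l ν (x mod NM) (q mod M)`.
* §2 **`abs_tsum_wH_diff_pshift_le`** — [our object] THE TORUS BOUND: at a block point `N•x′ + a_j`,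
  `|Σ_t [wH(… + e_ν) − wH(…)]| ≤ N^{−(d+3)}·MD163(d+1)·periodConst(κ₁₆₃(d+1), d)·e^{−(κ₁₆₃(d+1)∕(d+1))·|x′ − q|_{T_M,∞}}` (`norm_dker_bpt_le`).
* §3 `summable_wH_diff`, **`abs_wH_diff_block_le`** (cubic tori `k + 1 → ∞`, `abs_le_of_periodisations`), **`abs_wH_diff_le`** — [our object] THE LETTER displayed in the title.
* §4 THE ROAD READING: `colH_KInvStep_zero_eq_wH` (the undressed one-shot column IS `wH`, `KInvStep_zero_eq` + `KInv_inl_inr_coarse` — g53's dictionary line),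
  **`abs_colH_KInvStep_zero_diff_le`** (block-scale weight `e^{−c_d‖⌊u∕N⌋ − y‖∞}`, unit `N^{−(d+3)}`), **`abs_colH_KInvStep_zero_diff_le_l1`** (the fine `ℓ¹` weight shape
  `e^{c_d}·e^{−(c_d∕((d+1)N))·|u − N•y|₁}` of `biLoc_wsum` ∕ `colH_weight` ∕ g53's «G0-COL-ENV», via `GAN24/EnvelopeBlockSum.env_le_exp_l1`), and at `d = 3`, `n = m + 1`:
  **`abs_colH_KInvStep_zero_diff_road_le`**: `∀ u, |colH (KInvStep 3 n 0) n μ y κ (u + e_ρ) − colH (KInvStep 3 n 0) n μ y κ u| ≤ (n⁶)⁻¹·(C₄′·e^{κ′})·e^{−(κ′∕(4n))·|u − n•y|₁}`,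
  `C₄′ := MD163 4·periodConst (kappa163 4) 3`, `κ′ := kappa163 4∕4` — THE LOCATED COUNT `n⁻⁶`, UNCONDITIONAL; `colH_KInvStep_zero_diff_road_weight_nonneg`.
Unit `b2b-balaban-beta-d1-formalise-leaf-01` (gen 29), D1 formalisation swarm LEAF PROVER 01, road «BF-x» ((L1)(L2) packaging ∕ `RestKernelSandwichUnit∕Slot` ∕ g28
`UNITS-AT-THE-RAW-PIN.md` lineage); COMMISSION C-g23-1 (OWNER d1-p2 g23, journal l.49236); INTENT «L-h PART 1» (journal).  Not in print as stated; our bookkeeping over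
the tree's (1.63) certificates.  No existing file touched.
-/

noncomputable section

namespace Summit.QuantumFields.BalabanUV.Beta.D1BFx.MinimiserColumnGradient

open Finset Filter Topology
open scoped BigOperators
open Literature.MathematicalPhysics.QuantumFieldTheory
open Literature.MathematicalPhysics.QuantumFieldTheory.LatticeForm (quo)
open Literature.MathematicalPhysics.QuantumFieldTheory.Balaban1983to89
open Literature.MathematicalPhysics.QuantumFieldTheory.Balaban1983to89.Beta
open AffineAveraging (Site toSite unitVec)
open B12Sec2to5 (l1 l1_nonneg)
open B4ContourShift (supNorm)
open B4TorusKernel (periodConst)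
open B4TorusKernel.MultiPeriod (torusSupNorm)
open B5Prop11Plancherel (Tor fine)
open B5Block118 (bpt)
open B5Hk163Strip (kappa163 kappa163_pos)
open B5Hk163Torus (HkOp hker)
open B5Hk163TorusHolder (dker)
open B5Hk163TorusHolderDecay (MD163 norm_dker_bpt_le)
open KernelSpecInstance (wH)
open OneStepResolventKernel (KInv_inl_inr_coarse)
open OneStepKernelFamily (colH KInvStep)
open Summit.QuantumFields.BalabanUV.Beta.BorderedHessian (KInvStep_zero_eq)
open Summit.QuantumFields.BalabanUV.Beta.GAN24.TorusAvatar (toTor Periodic toTor_add toTor_unitVec toTor_bpt)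
open Summit.QuantumFields.BalabanUV.Beta.GAN24.TorusPeriodise (pshift pshift_injective)
open Summit.QuantumFields.BalabanUV.Beta.GAN24.EnvelopeBlockSum (env_le_exp_l1)
open Summit.QuantumFields.BalabanUV.Beta.FP.CompositeMinimiserDecay (tsum_wH_pshift_eq_HkOp periodic_toTor_block summable_wH
  torusSupNorm_cube_eq_supNorm)
open Summit.QuantumFields.BalabanUV.Beta.FP.PeriodisationBound (abs_le_of_periodisations)
open DressedMomentNormalisation (resOf)
open Summit.QuantumFields.BalabanUV.Beta.FP.PeriodicTransportSum (quotOf resSite_add_zsmul_quotOf)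

variable {d : ℕ} (N : ℕ) [NeZero N] (M : Fin (d + 1) → ℕ) [∀ ν, NeZero (M ν)]

/-! ## §1 The junction for the fine difference of the periodised column -/

/-- [folklore] a periodised translate of an2's minimiser kernel is summable (`summable_wH` along the injective `t ↦ c + (NM)•t`). -/
theorem summable_wH_translate (κ l : Fin (d + 1)) (c : Site (d + 1)) :
    Summable (fun t : Site (d + 1) => wH (N := N) κ l (c + pshift (fine N M) t)) :=
  (summable_wH N κ l).comp_injective (f := wH (N := N) κ l)
    (fun _ _ h => pshift_injective (fine N M) (add_left_cancel h))

/-- [folklore] THE DISPLAYED `1∕n`: `hker (x + e_ν) y − hker x y = n⁻¹ · dker ν x y` (`B5Hk163TorusHolder.dker` unfolded). -/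
theorem hker_add_unitVec_sub (κ l ν : Fin (d + 1)) (X : Tor (fine N M)) (Y : Tor M) :
    hker N M κ l (X + B5Prop11Plancherel.unitVec (fine N M) ν) Y - hker N M κ l X Y = ((N : ℂ))⁻¹ * dker N M κ l ν X Y := by
  have hN : (N : ℂ) ≠ 0 := Nat.cast_ne_zero.mpr (NeZero.ne N)
  show _ = ((N : ℂ))⁻¹ * ((N : ℂ) * (hker N M κ l (X + B5Prop11Plancherel.unitVec (fine N M) ν) Y - hker N M κ l X Y))
  rw [← mul_assoc, inv_mul_cancel₀ hN, one_mul]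

/-- **THE JUNCTION FOR THE DIFFERENCE** [folklore]: for every fine point `x ∈ ℤ^{d+1}`, coarse point `q ∈ ℤ^{d+1}` and fine direction `ν`,
`Σ_t [wH κ l (x − N•q + (NM)•t + e_ν) − wH κ l (x − N•q + (NM)•t)] = N^{−(d+2)} · N⁻¹ · dker N M κ l ν (x mod NM) (q mod M)` — two instances of
`CompositeMinimiserDecay.tsum_wH_pshift_eq_HkOp` (at `x + e_ν` and at `x`) subtracted (`Summable.tsum_sub`), `toTor_add`∕`toTor_unitVec`, and §1's `hker_add_unitVec_sub`. -/
theorem tsum_wH_diff_pshift_eq_dker (hN : 1 ≤ N) (κ l ν : Fin (d + 1)) (x q : Site (d + 1)) :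
    (((∑' t : Site (d + 1), (wH (N := N) κ l (x - (N : ℤ) • q + pshift (fine N M) t + unitVec ν)
        - wH (N := N) κ l (x - (N : ℤ) • q + pshift (fine N M) t))) : ℝ) : ℂ)
      = ((N : ℂ) ^ (d + 2))⁻¹ * ((N : ℂ))⁻¹ * dker N M κ l ν (toTor (fine N M) x) (toTor M q) := by
  have hs₁ := summable_wH_translate N M κ l (x + unitVec ν - (N : ℤ) • q)
  have hs₀ := summable_wH_translate N M κ l (x - (N : ℤ) • q)
  have e : (fun t : Site (d + 1) => wH (N := N) κ l (x - (N : ℤ) • q + pshift (fine N M) t + unitVec ν)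
        - wH (N := N) κ l (x - (N : ℤ) • q + pshift (fine N M) t))
      = fun t => wH (N := N) κ l (x + unitVec ν - (N : ℤ) • q + pshift (fine N M) t) - wH (N := N) κ l (x - (N : ℤ) • q + pshift (fine N M) t) := by
    funext t
    rw [show x - (N : ℤ) • q + pshift (fine N M) t + unitVec ν = x + unitVec ν - (N : ℤ) • q + pshift (fine N M) t from by abel]
  have h₁ := tsum_wH_pshift_eq_HkOp N M hN κ l (x + unitVec ν) q
  have h₀ := tsum_wH_pshift_eq_HkOp N M hN κ l x q
  rw [e, hs₁.tsum_sub hs₀, Complex.ofReal_sub, h₁, h₀, toTor_add, toTor_unitVec, ← mul_sub]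
  show ((N : ℂ) ^ (d + 2))⁻¹ * (hker N M κ l (toTor (fine N M) x + B5Prop11Plancherel.unitVec (fine N M) ν) (toTor M q)
      - hker N M κ l (toTor (fine N M) x) (toTor M q)) = _
  rw [hker_add_unitVec_sub, mul_assoc]

/-! ## §2 The torus bound for the difference -/

/-- **THE TORUS BOUND ON THE DIFFERENCE OF THE PERIODISED COLUMN** [our object]: for block index `x′`, digit vector `j`, coarse point `q` (all integer), fine
direction `ν` and EVERY torus `M`,
`|Σ_t [wH κ l (N•x′ + a_j − N•q + (NM)•t + e_ν) − wH κ l (N•x′ + a_j − N•q + (NM)•t)]| ≤ N^{−(d+3)} · MD163(d+1)·periodConst(κ₁₆₃(d+1), d) · e^{−(κ₁₆₃(d+1)∕(d+1))·|x′ − q|_{T_M,∞}}`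
— §1 + `B5Hk163TorusHolderDecay.norm_dker_bpt_le` (`toTor_bpt`: the fine class of `N•x′ + a_j` is the block point `bpt N M (x′ mod M) j`). -/
theorem abs_tsum_wH_diff_pshift_le (hN : 1 ≤ N) (κ l ν : Fin (d + 1)) (x' q : Site (d + 1)) (j : Fin (d + 1) → Fin N) :
    |∑' t : Site (d + 1), (wH (N := N) κ l ((N : ℤ) • x' + toSite (fun i => (j i : ℕ)) - (N : ℤ) • q + pshift (fine N M) t + unitVec ν)
        - wH (N := N) κ l ((N : ℤ) • x' + toSite (fun i => (j i : ℕ)) - (N : ℤ) • q + pshift (fine N M) t))|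
      ≤ ((N : ℝ) ^ (d + 3))⁻¹ * (MD163 (d + 1) * periodConst (kappa163 (d + 1)) d *
          Real.exp (-(kappa163 (d + 1) / (d + 1) * torusSupNorm M (x' - q)))) := by
  have hblock : toTor (fine N M) ((N : ℤ) • x' + toSite (fun i => (j i : ℕ))) = bpt N M (toTor M x') j := by
    rw [← toTor_bpt N M (toTor M x') j]
    exact ((periodic_toTor_block N M (toSite (fun i => (j i : ℕ)))).apply_liftT_toTor x').symm
  have h := tsum_wH_diff_pshift_eq_dker N M hN κ l ν ((N : ℤ) • x' + toSite (fun i => (j i : ℕ))) q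
  rw [hblock] at h
  have hnorm : |∑' t : Site (d + 1), (wH (N := N) κ l ((N : ℤ) • x' + toSite (fun i => (j i : ℕ)) - (N : ℤ) • q + pshift (fine N M) t + unitVec ν)
        - wH (N := N) κ l ((N : ℤ) • x' + toSite (fun i => (j i : ℕ)) - (N : ℤ) • q + pshift (fine N M) t))|
      = ((N : ℝ) ^ (d + 2))⁻¹ * ((N : ℝ))⁻¹ * ‖dker N M κ l ν (bpt N M (toTor M x') j) (toTor M q)‖ := by
    rw [← Real.norm_eq_abs, ← Complex.norm_real, h, norm_mul, norm_mul, norm_inv, norm_inv, norm_pow, Complex.norm_natCast]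
  have hpow : ((N : ℝ) ^ (d + 3))⁻¹ = ((N : ℝ) ^ (d + 2))⁻¹ * ((N : ℝ))⁻¹ := by
    rw [pow_succ, mul_inv]
  rw [hnorm, ← hpow]
  refine mul_le_mul_of_nonneg_left ?_ (by positivity)
  exact norm_dker_bpt_le N M κ l ν j x' q

/-! ## §3 De-periodisation: the gradient letter on `ℤ^{d+1}` -/

/-- [folklore] the fine difference of an2's minimiser kernel is absolutely summable (two summable translates). -/
theorem summable_wH_diff (κ l ν : Fin (d + 1)) :
    Summable (fun z : Site (d + 1) => wH (N := N) κ l (z + unitVec ν) - wH (N := N) κ l z) :=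
  ((summable_wH N κ l).comp_injective (f := wH (N := N) κ l) (add_left_injective (unitVec ν))).sub (summable_wH N κ l)

/-- **THE GRADIENT OF THE fm LEG ON `ℤ^{d+1}`, UNCONDITIONAL** [our object]: for every `d`, every `N ≥ 1`, fine direction `κ`, coarse bond direction `l`, fine
difference direction `ν`, block index `x′ ∈ ℤ^{d+1}`, digit vector `j` and coarse point `q ∈ ℤ^{d+1}`,
`|wH κ l (N•x′ + a_j − N•q + e_ν) − wH κ l (N•x′ + a_j − N•q)| ≤ N^{−(d+3)} · (MD163(d+1)·periodConst(κ₁₆₃(d+1), d)) · e^{−(κ₁₆₃(d+1)∕(d+1))·‖x′ − q‖∞}`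
— §2 on the cubic tori `M = (k+1, …, k+1)` and `PeriodisationBound.abs_le_of_periodisations` (`k → ∞`; `|x′ − q|_{T_M,∞} = ‖x′ − q‖∞` once `k + 1 ≥ 2‖x′ − q‖∞`),
VERBATIM the route of `CompositeMinimiserDecay.abs_wH_block_le` with `w := z ↦ wH κ l (z + e_ν) − wH κ l z`. -/
theorem abs_wH_diff_block_le (hN : 1 ≤ N) (κ l ν : Fin (d + 1)) (x' q : Site (d + 1)) (j : Fin (d + 1) → Fin N) :
    |wH (N := N) κ l ((N : ℤ) • x' + toSite (fun i => (j i : ℕ)) - (N : ℤ) • q + unitVec ν)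
        - wH (N := N) κ l ((N : ℤ) • x' + toSite (fun i => (j i : ℕ)) - (N : ℤ) • q)|
      ≤ ((N : ℝ) ^ (d + 3))⁻¹ * (MD163 (d + 1) * periodConst (kappa163 (d + 1)) d) *
          Real.exp (-(kappa163 (d + 1) / (d + 1) * supNorm (x' - q))) := by
  -- the cubic tori and their fine period lattices
  let P : ℕ → Fin (d + 1) → ℕ := fun k => fine N (fun _ : Fin (d + 1) => k + 1)
  have hP1 : ∀ k ν, 1 ≤ P k ν := fun k ν => by
    show 1 ≤ N * (k + 1)
    exact Nat.one_le_iff_ne_zero.mpr (Nat.mul_ne_zero (NeZero.ne N) (Nat.succ_ne_zero k))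
  have hP : ∀ R : ℕ, ∀ᶠ k in atTop, ∀ ν, R ≤ P k ν := fun R => by
    refine (eventually_ge_atTop R).mono fun k hk ν => ?_
    show R ≤ N * (k + 1)
    calc R ≤ k + 1 := hk.trans (Nat.le_succ k)
      _ ≤ N * (k + 1) := Nat.le_mul_of_pos_left _ hN
  -- the eventual torus bound, with the torus distance already the lattice distance
  have hB : ∀ᶠ k in atTop,
      |∑' t : Site (d + 1), (wH (N := N) κ l ((N : ℤ) • x' + toSite (fun i => (j i : ℕ)) - (N : ℤ) • q + pshift (P k) t + unitVec ν)
          - wH (N := N) κ l ((N : ℤ) • x' + toSite (fun i => (j i : ℕ)) - (N : ℤ) • q + pshift (P k) t))|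
        ≤ ((N : ℝ) ^ (d + 3))⁻¹ * (MD163 (d + 1) * periodConst (kappa163 (d + 1)) d) *
            Real.exp (-(kappa163 (d + 1) / (d + 1) * supNorm (x' - q))) := by
    obtain ⟨R, hR⟩ : ∃ R : ℕ, ∀ i, 2 * |(x' - q) i| ≤ (R : ℤ) :=
      ⟨2 * Finset.univ.sup (fun i => ((x' - q) i).natAbs), fun i => by
        have h1 : ((x' - q) i).natAbs ≤ Finset.univ.sup (fun i => ((x' - q) i).natAbs) :=
          Finset.le_sup (f := fun i => ((x' - q) i).natAbs) (Finset.mem_univ i)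
        have h2 : |(x' - q) i| = (((x' - q) i).natAbs : ℤ) := (Int.natCast_natAbs _).symm
        rw [h2]; push_cast; omega⟩
    refine (eventually_ge_atTop R).mono fun k hk => ?_
    have hk' : ∀ i, 2 * |(x' - q) i| ≤ ((k + 1 : ℕ) : ℤ) := fun i => (hR i).trans (by exact_mod_cast hk.trans (Nat.le_succ k))
    have h := abs_tsum_wH_diff_pshift_le N (fun _ : Fin (d + 1) => k + 1) hN κ l ν x' q j
    rw [torusSupNorm_cube_eq_supNorm (x' - q) hk'] at h
    refine h.trans (le_of_eq ?_)
    ring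
  exact abs_le_of_periodisations (summable_wH_diff N κ l ν) _ hP1 hP hB

/-- **THE GRADIENT OF THE fm LEG ON `ℤ^{d+1}` AT AN ARBITRARY FINE POINT** [our object] (the letter of the title): for every `z, q ∈ ℤ^{d+1}` and fine direction `ν`,
`|wH κ l (z − N•q + e_ν) − wH κ l (z − N•q)| ≤ N^{−(d+3)} · (MD163(d+1)·periodConst(κ₁₆₃(d+1), d)) · e^{−(κ₁₆₃(d+1)∕(d+1))·‖⌊z∕N⌋ − q‖∞}` — `abs_wH_diff_block_le` at the
coordinatewise Euclidean decomposition `z = N•⌊z∕N⌋ + (z mod N)` (`PeriodicTransportSum.resSite_add_zsmul_quotOf`; `⌊z∕N⌋ = quotOf N z`). -/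
theorem abs_wH_diff_le (hN : 1 ≤ N) (κ l ν : Fin (d + 1)) (z q : Site (d + 1)) :
    |wH (N := N) κ l (z - (N : ℤ) • q + unitVec ν) - wH (N := N) κ l (z - (N : ℤ) • q)|
      ≤ ((N : ℝ) ^ (d + 3))⁻¹ * (MD163 (d + 1) * periodConst (kappa163 (d + 1)) d) *
          Real.exp (-(kappa163 (d + 1) / (d + 1) * supNorm (quotOf N z - q))) := by
  have h := abs_wH_diff_block_le N hN κ l ν (quotOf N z) q (resOf hN z)
  have e : (N : ℤ) • quotOf N z + toSite (fun i => ((resOf hN z i : ℕ))) = z :=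
    (add_comm _ _).trans (resSite_add_zsmul_quotOf hN z)
  rw [e] at h
  exact h

/-! ## §4 The road reading: the undressed one-shot column `colH (KInvStep d N 0) N` -/

/-- [folklore] THE UNDRESSED ONE-SHOT COLUMN IS THE MINIMISER KERNEL (g53's dictionary line of `PackedColumnEnvelope.abs_colH_KInvStep_zero_le`, displayed):
`colH (KInvStep d N 0) N μ y κ u = wH^{(N)} κ μ (u − N•y)` (`KInvStep_zero_eq`, `KInv_inl_inr_coarse`). -/
theorem colH_KInvStep_zero_eq_wH (μ : Fin (d + 1)) (y : Site (d + 1)) (κ : Fin (d + 1)) (u : Site (d + 1)) :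
    colH (KInvStep (d := d) N 0) N μ y κ u = wH (N := N) κ μ (u - (N : ℤ) • y) := by
  unfold OneStepKernelFamily.colH
  rw [KInvStep_zero_eq, KInv_inl_inr_coarse]

/-- **L-h FOR THE STRAIGHT COLUMN, BLOCK-SCALE WEIGHT** [our object]: for every `N ≥ 1`, coarse bond `(μ, y)`, fine direction `κ`, fine point `u` and difference direction `ρ`,
`|colH (KInvStep d N 0) N μ y κ (u + e_ρ) − colH (KInvStep d N 0) N μ y κ u| ≤ N^{−(d+3)}·(MG-free constant `MD163(d+1)·periodConst(κ₁₆₃(d+1), d)`)·e^{−(κ₁₆₃(d+1)∕(d+1))·‖⌊u∕N⌋ − y‖∞}` —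
ONE power of `N` above the column's own envelope `abs_colH_KInvStep_zero_le` (`N^{−(d+2)}`), UNCONDITIONAL. -/
theorem abs_colH_KInvStep_zero_diff_le (hN : 1 ≤ N) (μ : Fin (d + 1)) (y : Site (d + 1)) (κ : Fin (d + 1)) (u : Site (d + 1)) (ρ : Fin (d + 1)) :
    |colH (KInvStep (d := d) N 0) N μ y κ (u + unitVec ρ) - colH (KInvStep (d := d) N 0) N μ y κ u|
      ≤ ((N : ℝ) ^ (d + 3))⁻¹ * (MD163 (d + 1) * periodConst (kappa163 (d + 1)) d) *
          Real.exp (-(kappa163 (d + 1) / ((d : ℝ) + 1) * supNorm (quo N u - y))) := by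
  have h := abs_wH_diff_le (d := d) N hN κ μ ρ u y
  have hq : quotOf N u = quo N u := rfl
  rw [hq] at h
  rw [colH_KInvStep_zero_eq_wH, colH_KInvStep_zero_eq_wH, add_sub_right_comm]
  exact_mod_cast h

/-- **L-h FOR THE STRAIGHT COLUMN IN THE FINE `ℓ¹` CURRENCY** [our object] (the weight shape `hw` of `biLoc_wsum` ∕ `colH_weight` ∕ the jets' mass letters ∕ g53's «G0-COL-ENV»):
`|colH (KInvStep d N 0) N μ y κ (u + e_ρ) − colH (…) κ u| ≤ N^{−(d+3)}·(C_d·e^{c_d})·e^{−(c_d∕((d+1)N))·|u − N•y|₁}`, `C_d := MD163(d+1)·periodConst(κ₁₆₃(d+1), d)`,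
`c_d := κ₁₆₃(d+1)∕(d+1)` (`env_le_exp_l1`). -/
theorem abs_colH_KInvStep_zero_diff_le_l1 (hN : 1 ≤ N) (μ : Fin (d + 1)) (y : Site (d + 1)) (κ : Fin (d + 1)) (u : Site (d + 1)) (ρ : Fin (d + 1)) :
    |colH (KInvStep (d := d) N 0) N μ y κ (u + unitVec ρ) - colH (KInvStep (d := d) N 0) N μ y κ u|
      ≤ ((N : ℝ) ^ (d + 3))⁻¹ * ((MD163 (d + 1) * periodConst (kappa163 (d + 1)) d) * Real.exp (kappa163 (d + 1) / ((d : ℝ) + 1)))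
          * Real.exp (-(kappa163 (d + 1) / ((d : ℝ) + 1) / (((d : ℝ) + 1) * N)) * l1 (u - (N : ℤ) • y)) := by
  refine (abs_colH_KInvStep_zero_diff_le (d := d) N hN μ y κ u ρ).trans ?_
  have hc : 0 ≤ kappa163 (d + 1) / ((d : ℝ) + 1) := div_nonneg (kappa163_pos (d + 1)).le (by positivity)
  have h := env_le_exp_l1 (d := d) hN hc y u
  have hN0 : (0 : ℝ) < N := by exact_mod_cast hN
  have hC : 0 ≤ MD163 (d + 1) * periodConst (kappa163 (d + 1)) d := by
    -- sign read-off from the bound itself at `u`: `0 ≤ |·| ≤ N^{−(d+3)}·C·e^{…}` with positive outer factors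
    have h0 := (mul_nonneg_iff_of_pos_right (Real.exp_pos _)).1
      ((abs_nonneg _).trans (abs_colH_KInvStep_zero_diff_le (d := d) N hN μ y κ u ρ))
    exact (mul_nonneg_iff_of_pos_left (inv_pos.mpr (pow_pos hN0 _))).1 h0
  calc ((N : ℝ) ^ (d + 3))⁻¹ * (MD163 (d + 1) * periodConst (kappa163 (d + 1)) d)
          * Real.exp (-(kappa163 (d + 1) / ((d : ℝ) + 1) * supNorm (quo N u - y)))
      ≤ ((N : ℝ) ^ (d + 3))⁻¹ * (MD163 (d + 1) * periodConst (kappa163 (d + 1)) d)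
          * (Real.exp (kappa163 (d + 1) / ((d : ℝ) + 1))
            * Real.exp (-(kappa163 (d + 1) / ((d : ℝ) + 1) / (((d : ℝ) + 1) * N)) * l1 (u - (N : ℤ) • y))) :=
        mul_le_mul_of_nonneg_left h (mul_nonneg (inv_nonneg.mpr (pow_nonneg hN0.le _)) hC)
    _ = _ := by ring

/-- **L-h FOR THE ROAD's STRAIGHT COLUMN** [our object] (`d = 3`, block side `n = m + 1`, ANY coarse bond `(μ, y)`, ANY fine direction `κ`, ANY difference direction `ρ`):
`∀ u, |colH (KInvStep 3 n 0) n μ y κ (u + e_ρ) − colH (KInvStep 3 n 0) n μ y κ u| ≤ (n⁶)⁻¹·(C₄′·e^{κ′})·e^{−(κ′∕(4n))·|u − n•y|₁}`, `C₄′ = MD163 4·periodConst (kappa163 4) 3`,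
`κ′ = kappa163 4 ∕ 4` — THE LOCATED COUNT `n⁻⁶` (one power above the column's `n⁻⁵`), UNCONDITIONAL; the weight is EXACTLY the road's (g53 `abs_colH_G₀_road_le`,
gan24-leaf-05 `CombColumnEnvelope.abs_colH_GcombSh_road_le`). -/
theorem abs_colH_KInvStep_zero_diff_road_le (m : ℕ) (μ : Fin (3 + 1)) (y : Fin (3 + 1) → ℤ) (κ ρ : Fin (3 + 1)) :
    ∀ u : Fin (3 + 1) → ℤ, |colH (KInvStep (d := 3) (m + 1) 0) (m + 1) μ y κ (u + unitVec ρ) - colH (KInvStep (d := 3) (m + 1) 0) (m + 1) μ y κ u|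
      ≤ ((((m + 1 : ℕ) : ℝ) ^ 6)⁻¹ * ((MD163 4 * periodConst (kappa163 4) 3) * Real.exp (kappa163 4 / 4)))
        * Real.exp (-(kappa163 4 / 4 / (4 * ((m + 1 : ℕ) : ℝ))) * l1 (u - ((m + 1 : ℕ) : ℤ) • y)) := by
  intro u
  have h := abs_colH_KInvStep_zero_diff_le_l1 (d := 3) (N := m + 1) (Nat.le_add_left 1 m) μ y κ u ρ
  have e3 : ((3 : ℕ) : ℝ) + 1 = 4 := by norm_num
  simp only [e3] at h
  exact h

/-- [folklore] The road's gradient-weight constant is nonnegative (for the `hC` slots of `biLoc_wsum`-type lemmas). -/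
theorem colH_KInvStep_zero_diff_road_weight_nonneg (m : ℕ) :
    0 ≤ ((((m + 1 : ℕ) : ℝ) ^ 6)⁻¹ * ((MD163 4 * periodConst (kappa163 4) 3) * Real.exp (kappa163 4 / 4))) := by
  have h := abs_colH_KInvStep_zero_diff_road_le m 0 0 0 0 0
  exact (mul_nonneg_iff_of_pos_right (Real.exp_pos _)).1 ((abs_nonneg _).trans h)

end Summit.QuantumFields.BalabanUV.Beta.D1BFx.MinimiserColumnGradient

end
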